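import Summits.ValiantsHypothesis.ValiantsHypothesis.Theses.AnyonJets

/-!
# Birth skeleton — crux `JetConstantElim` (item `stmt-ValiantsHypothesis-16737`), line `birth`

Route `route-ValiantsHypothesis-AnyonJets`, crux
`Summit.ValiantsHypothesis.ValiantsHypothesis.Theses.AnyonJets.JetConstantElim`
(CONSTANT ELIMINATION INSIDE VP FOR THE ANYONIC JETS: one exponent `b` with
`τ(J_(n,k)) ≤ (L_ℂ(J_(n,k)) + n + 2)^b` for all `n` and all `k ≤ log₂ n`, where
`J_(n,k) = Σ_σ sgn(σ)·C(inv σ, k)·x^σ ∈ ℤ[x]`, `τ` = constant-free fan-in-two complexity over `ℤ`,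
`L_ℂ` = fan-in-two complexity over `ℂ`).

## The line: FIELD OF DEFINITION ⟶ LATTICE ⟶ MULTIPLIER (the route's TWO-LAYER PLAN
`JetConstantElim ⇐ HeightNormalForm → IntegralToSignConstants`, cut one joint finer)

A complex circuit for the integer polynomial `J_(n,k)` is converted into a constant-free one in
four moves, each a stub; the two KNOWN moves bracket the two OPEN ones, and the two open ones carry
DISJOINT obstructions (degree/height of the field of definition vs. the integer-multiplier problem
of the constant-free model), so that neither is the crux again:

* `stub_algebraicDescent` (KNOWN — Bürgisser–Clausen–Shokrollahi 1997 Def. (4.15), Prop. (4.16),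
  Thm. (4.17)(2): `k ⊆ K` is AUTARKICAL (`L_K = L_k` on `k(X)`) when `k` is algebraically closed, by
  Hilbert's Nullstellensatz; Bürgisser 2000 §4.1): an optimal `ℂ`-circuit for
  an integer polynomial can be taken with ALGEBRAIC constants — for every `f ∈ ℤ[x_σ]` some
  fan-in-two circuit over `ℚ̄ = AlgebraicClosure ℚ` of size `≤ L_ℂ(f)` computes `f`. (The
  skeleton `P(y) = f` is a finite system of integer polynomial equations in the constant slots `y`,
  solvable in `ℂ`, hence in `ℚ̄`.) Size L in Lean (coefficient comparison + Nullstellensatz transfer).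
* `stub_integralMultiple` (OPEN — the "field-of-definition" half): for `k ≤ log₂ n`, from any
  fan-in-two `ℚ̄`-circuit `Q` for `J_(n,k)` one gets an INTEGER circuit `P` with constants of
  absolute value `≤ 2^t` computing some POSITIVE INTEGER MULTIPLE `M·J_(n,k)`, with
  `size(P) + t + 2 ≤ (size(Q) + n + 2)^b₁`. Denominators are absorbed by `M`, so the only content
  is: near-optimal circuits of the explicit easy families `J_k` can be defined over a number field
  of polynomial DEGREE with algebraic integers of polynomial HEIGHT (then the regular representation
  `ℤ[θ] ≅ ℤ^d` simulates them integrally, and exponent balancing at the sum gates produces the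
  multiplier `M = N^e`). What might kill it: near-optimal circuits for `J_k` that need roots of
  unity of superpolynomial order / constants of superpolynomial degree (Bürgisser 2000 Ch. 4;
  Koiran 2004; the VP_ℂ-versus-VP_ℚ̄-versus-VP_K question INSIDE VP at fixed-polynomial granularity).
* `stub_signSimulation` (KNOWN — Bürgisser 2000 §1.4, Bürgisser 2009 §2.2 `τ(m) ≤ 2 log₂ m`,
  Malod 2003; in tree: the `τ`-calculus of `ConstantFreeCircuits.lean`, esp. the substitution bound
  `constantFreeComplexity_aeval_le`): an integer fan-in-two circuit of size `s` whose constants and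
  sum coefficients are bounded by `2^t` in absolute value is simulated constant-freely in size
  `≤ (s + t + 2)^b₂` (treat the constants as fresh inputs, substitute their `O(t)`-gate binary
  expansions). Size M in Lean.
* `stub_multiplierRemoval` (OPEN — the "VP⁰-multiplier" half; Koiran–Perifel 2011 Rem. 4,
  Bürgisser 2009 Thm 2.10 = in-tree fact `Burgisser2009_thm210` (the `2^{p(n)}` factor), Koiran 2004):
  for the jets, an integer multiplier buys at most a `k`-independent polynomial:
  `τ(J_(n,k)) ≤ (τ(M·J_(n,k)) + n + 2)^b₃` for all `M ≥ 1`, `k ≤ log₂ n`. What might kill it: an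
  explicit multiplier `M` (a large power of `2` is the first suspect, by the 2-adic shadow of the
  route) making `M·J_k` uniformly cheap — an unbounded gap between VP⁰ and its closure under integer
  division on explicit easy families, excluded by nothing in print.

Both open stubs are CONSEQUENCES of the crux modulo the known ones (`M = 1`; resp. `L_ℂ(J) ≤
τ(M·J) + 1` by `eval_map_holds` and one `1/M`-gate), and jointly with the known ones they give it
back (`JetConstantElim_of`, kernel-checked below): the crux is cut, not restated. Neither stub, nor
any single one of the four, gives `JetConstantElim` or `ValiantsHypothesis` by a cheap implication
(BC3 probes `stub → JetConstantElim`, `stub → ValiantsHypothesis` by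
`first | exact? | simpa | aesop` all FAIL — registrar's NOTES.md / `Lines/birth.md`).

## Shape (skeleton audit by-name rule, device of `Cruxes/ClassTransfer/Lines/birth.lean`)
* `AlgebraicDescent`, `IntegralMultiple`, `SignSimulation`, `MultiplierRemoval` — the four stub
  statements as named `Prop`s (verbatim the stub signatures; the inversion-count jet `J` is inlined
  by a `let`, rfl-equal to the route's items, and the height bound is an explicit conjunction over
  `ArithCircuit.gates` / `Gate.args` / `output`, so every stub is DEF-FREE beyond Mathlib +
  `Literature.Computability.AlgebraicComplexity.ArithCircuit` and can land as
  `Theorems/AnyonJetsJetConstantElim<Stub>.lean` with `--supports stmt-ValiantsHypothesis-16737`);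
* `stub_…` — the same statements as sorried theorems (the REGISTERED stubs; `sorry` nowhere else);
* `Registered.stub_…` — name-keyed aliases (hypotheses of the composition must be admissible BY NAME);
* `assemble` — the arithmetic of the composition for an arbitrary family `F` and height predicate;
* `JetConstantElim_of : Registered.stub_algebraicDescent → Registered.stub_integralMultiple →
  Registered.stub_signSimulation → Registered.stub_multiplierRemoval → JetConstantElim` — real proof,
  exponent `b = (b₁·b₂ + 2)·b₃`; the final `example : JetConstantElim` wires the sorried stubs in.

**Disproof used.** None exists: `ledger crux ls stmt-ValiantsHypothesis-16737` = no workfiles (no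
`Disproof.lean`, no `_false_without_` theorem, no `Negative/` lemma) at registration (2026-08-17);
`ledger negatives --problem ValiantsHypothesis` (4 entries: UlrichPadded tightness, elusive candidate,
Grenet uniqueness ×2) is disjoint from every statement here. Hardest stub: `stub_integralMultiple`.
-/

set_option linter.dupNamespace false

namespace Summit.ValiantsHypothesis.ValiantsHypothesis.Cruxes.JetConstantElim.Birth

open Summit.ValiantsHypothesis.ValiantsHypothesis.Theses.AnyonJets
open Literature.Computability.AlgebraicComplexity

/-! ## The four stub statements, named -/

/-- **AlgebraicDescent** (stub statement, named): for every integer polynomial `f` some fan-in-two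
circuit over `ℚ̄ = AlgebraicClosure ℚ` of size at most `L_ℂ(f)` computes `f` — optimal complex
circuits for integer polynomials can be taken with algebraic constants. [known:
BurgisserClausenShokrollahi1997 Thm. (4.17)(2) with Prop. (4.16) (an algebraically closed subfield is
autarkical: the complexity does not drop in any field extension; Hilbert's Nullstellensatz),
Burgisser2000 §4.1; in tree `exists_computes_size_eq_complexity` supplies the optimal `ℂ`-circuit] -/
def AlgebraicDescent : Prop :=
  ∀ (σ : Type) (f : MvPolynomial σ ℤ),
    ∃ Q : Literature.Computability.AlgebraicComplexity.ArithCircuit (AlgebraicClosure ℚ) σ,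
      Q.IsFanInTwo ∧
      Q.Computes (MvPolynomial.map (Int.castRingHom (AlgebraicClosure ℚ)) f) ∧
      Q.size ≤ Literature.Computability.AlgebraicComplexity.complexity
        (MvPolynomial.map (Int.castRingHom ℂ) f)

/-- **IntegralMultiple** (stub statement, named; OPEN — field-of-definition half of the crux): for
`k ≤ log₂ n`, any fan-in-two `ℚ̄`-circuit `Q` for the jet `J_(n,k)` yields an integer fan-in-two
circuit `P` with all constants and sum coefficients of absolute value `≤ 2^t` computing a positive
integer multiple `M·J_(n,k)`, with `size(P) + t + 2 ≤ (size(Q) + n + 2)^b₁`, `b₁` absolute.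
[conjecture-grade: Burgisser2000 Ch. 4, Koiran2004, KoiranPerifel2011, Malod2003] -/
def IntegralMultiple : Prop :=
  let J := fun (n k : ℕ) => (∑ σ : Equiv.Perm (Fin n), MvPolynomial.C (((Equiv.Perm.sign σ : ℤˣ) : ℤ) * (((Finset.univ.filter (fun p : Fin n × Fin n => p.1 < p.2 ∧ σ p.2 < σ p.1)).card.choose k : ℕ) : ℤ)) * ∏ i : Fin n, MvPolynomial.X (σ i, i) : MvPolynomial (Fin n × Fin n) ℤ);
  ∃ b₁ : ℕ, ∀ n k : ℕ, k ≤ Nat.log 2 n →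
    ∀ Q : Literature.Computability.AlgebraicComplexity.ArithCircuit (AlgebraicClosure ℚ) (Fin n × Fin n),
      Q.IsFanInTwo →
      Q.Computes (MvPolynomial.map (Int.castRingHom (AlgebraicClosure ℚ)) (J n k)) →
      ∃ (P : Literature.Computability.AlgebraicComplexity.ArithCircuit ℤ (Fin n × Fin n)) (t M : ℕ),
        1 ≤ M ∧ P.IsFanInTwo ∧ P.Computes ((M : ℤ) • J n k) ∧
        ((∀ g ∈ P.gates, ∀ u ∈ g.args, ∀ c : ℤ, u = .const c → c.natAbs ≤ 2 ^ t) ∧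
          (∀ args : List (ℤ × Literature.Computability.AlgebraicComplexity.ArithCircuit.Operand ℤ (Fin n × Fin n)),
            Literature.Computability.AlgebraicComplexity.ArithCircuit.Gate.sum args ∈ P.gates →
              ∀ a ∈ args, a.1.natAbs ≤ 2 ^ t) ∧
          (∀ c : ℤ, P.output = .const c → c.natAbs ≤ 2 ^ t)) ∧
        P.size + t + 2 ≤ (Q.size + n + 2) ^ b₁

/-- **SignSimulation** (stub statement, named): an integer fan-in-two circuit of size `s` computing
`f`, all of whose constants and sum coefficients have absolute value `≤ 2^t`, is simulated by a
constant-free (sign-constant) fan-in-two circuit of size `≤ (s + t + 2)^b₂`, `b₂` absolute.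
[known: Burgisser2000 §1.4, Burgisser2009 §2.2 (`τ(m) ≤ 2 log₂ m`), Malod2003; in tree
`constantFreeComplexity_aeval_le` (substitution bound) and the `τ`-calculus of
`ConstantFreeCircuits.lean`] -/
def SignSimulation : Prop :=
  ∃ b₂ : ℕ, ∀ (σ : Type) (f : MvPolynomial σ ℤ)
    (P : Literature.Computability.AlgebraicComplexity.ArithCircuit ℤ σ) (t : ℕ),
    P.IsFanInTwo → P.Computes f →
    ((∀ g ∈ P.gates, ∀ u ∈ g.args, ∀ c : ℤ, u = .const c → c.natAbs ≤ 2 ^ t) ∧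
      (∀ args : List (ℤ × Literature.Computability.AlgebraicComplexity.ArithCircuit.Operand ℤ σ),
        Literature.Computability.AlgebraicComplexity.ArithCircuit.Gate.sum args ∈ P.gates →
          ∀ a ∈ args, a.1.natAbs ≤ 2 ^ t) ∧
      (∀ c : ℤ, P.output = .const c → c.natAbs ≤ 2 ^ t)) →
    Literature.Computability.AlgebraicComplexity.constantFreeComplexity f ≤ (P.size + t + 2) ^ b₂

/-- **MultiplierRemoval** (stub statement, named; OPEN — the VP⁰-multiplier half of the crux): for
the jets an integer multiplier buys at most a `k`-independent polynomial constant-freely: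
`τ(J_(n,k)) ≤ (τ(M·J_(n,k)) + n + 2)^b₃` for all `n`, all `k ≤ log₂ n`, all `M ≥ 1`, `b₃` absolute.
[conjecture-grade: KoiranPerifel2011 Rem. 4, Burgisser2009 Thm 2.10 (`Burgisser2009_thm210` in
tree: the `2^{p(n)}` factor), Koiran2004] -/
def MultiplierRemoval : Prop :=
  let J := fun (n k : ℕ) => (∑ σ : Equiv.Perm (Fin n), MvPolynomial.C (((Equiv.Perm.sign σ : ℤˣ) : ℤ) * (((Finset.univ.filter (fun p : Fin n × Fin n => p.1 < p.2 ∧ σ p.2 < σ p.1)).card.choose k : ℕ) : ℤ)) * ∏ i : Fin n, MvPolynomial.X (σ i, i) : MvPolynomial (Fin n × Fin n) ℤ);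
  ∃ b₃ : ℕ, ∀ n k M : ℕ, k ≤ Nat.log 2 n → 1 ≤ M →
    Literature.Computability.AlgebraicComplexity.constantFreeComplexity (J n k) ≤
      (Literature.Computability.AlgebraicComplexity.constantFreeComplexity ((M : ℤ) • J n k) + n + 2) ^ b₃

/-! ## The registered stubs (signatures = the named statements verbatim; `sorry` only here) -/

/-- Stub AlgebraicDescent (registered obligation; signature = `AlgebraicDescent` verbatim).
[known — BurgisserClausenShokrollahi1997 Thm. (4.17)(2) / Prop. (4.16) (autarky of algebraically
closed subfields, Nullstellensatz), Burgisser2000 §4.1; `exists_computes_size_eq_complexity`] -/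
theorem stub_algebraicDescent :
    ∀ (σ : Type) (f : MvPolynomial σ ℤ),
      ∃ Q : Literature.Computability.AlgebraicComplexity.ArithCircuit (AlgebraicClosure ℚ) σ,
        Q.IsFanInTwo ∧
        Q.Computes (MvPolynomial.map (Int.castRingHom (AlgebraicClosure ℚ)) f) ∧
        Q.size ≤ Literature.Computability.AlgebraicComplexity.complexity
          (MvPolynomial.map (Int.castRingHom ℂ) f) := by
  sorry

/-- Stub IntegralMultiple (registered obligation; signature = `IntegralMultiple` verbatim).
[OPEN — Burgisser2000 Ch. 4, Koiran2004, KoiranPerifel2011, Malod2003] -/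
theorem stub_integralMultiple :
    let J := fun (n k : ℕ) => (∑ σ : Equiv.Perm (Fin n), MvPolynomial.C (((Equiv.Perm.sign σ : ℤˣ) : ℤ) * (((Finset.univ.filter (fun p : Fin n × Fin n => p.1 < p.2 ∧ σ p.2 < σ p.1)).card.choose k : ℕ) : ℤ)) * ∏ i : Fin n, MvPolynomial.X (σ i, i) : MvPolynomial (Fin n × Fin n) ℤ);
    ∃ b₁ : ℕ, ∀ n k : ℕ, k ≤ Nat.log 2 n →
      ∀ Q : Literature.Computability.AlgebraicComplexity.ArithCircuit (AlgebraicClosure ℚ) (Fin n × Fin n),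
        Q.IsFanInTwo →
        Q.Computes (MvPolynomial.map (Int.castRingHom (AlgebraicClosure ℚ)) (J n k)) →
        ∃ (P : Literature.Computability.AlgebraicComplexity.ArithCircuit ℤ (Fin n × Fin n)) (t M : ℕ),
          1 ≤ M ∧ P.IsFanInTwo ∧ P.Computes ((M : ℤ) • J n k) ∧
          ((∀ g ∈ P.gates, ∀ u ∈ g.args, ∀ c : ℤ, u = .const c → c.natAbs ≤ 2 ^ t) ∧
            (∀ args : List (ℤ × Literature.Computability.AlgebraicComplexity.ArithCircuit.Operand ℤ (Fin n × Fin n)),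
              Literature.Computability.AlgebraicComplexity.ArithCircuit.Gate.sum args ∈ P.gates →
                ∀ a ∈ args, a.1.natAbs ≤ 2 ^ t) ∧
            (∀ c : ℤ, P.output = .const c → c.natAbs ≤ 2 ^ t)) ∧
          P.size + t + 2 ≤ (Q.size + n + 2) ^ b₁ := by
  sorry

/-- Stub SignSimulation (registered obligation; signature = `SignSimulation` verbatim).
[known — Burgisser2000 §1.4, Burgisser2009 §2.2, Malod2003; `constantFreeComplexity_aeval_le`] -/
theorem stub_signSimulation :
    ∃ b₂ : ℕ, ∀ (σ : Type) (f : MvPolynomial σ ℤ)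
      (P : Literature.Computability.AlgebraicComplexity.ArithCircuit ℤ σ) (t : ℕ),
      P.IsFanInTwo → P.Computes f →
      ((∀ g ∈ P.gates, ∀ u ∈ g.args, ∀ c : ℤ, u = .const c → c.natAbs ≤ 2 ^ t) ∧
        (∀ args : List (ℤ × Literature.Computability.AlgebraicComplexity.ArithCircuit.Operand ℤ σ),
          Literature.Computability.AlgebraicComplexity.ArithCircuit.Gate.sum args ∈ P.gates →
            ∀ a ∈ args, a.1.natAbs ≤ 2 ^ t) ∧
        (∀ c : ℤ, P.output = .const c → c.natAbs ≤ 2 ^ t)) →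
      Literature.Computability.AlgebraicComplexity.constantFreeComplexity f ≤ (P.size + t + 2) ^ b₂ := by
  sorry

/-- Stub MultiplierRemoval (registered obligation; signature = `MultiplierRemoval` verbatim).
[OPEN — KoiranPerifel2011 Rem. 4, Burgisser2009 Thm 2.10, Koiran2004] -/
theorem stub_multiplierRemoval :
    let J := fun (n k : ℕ) => (∑ σ : Equiv.Perm (Fin n), MvPolynomial.C (((Equiv.Perm.sign σ : ℤˣ) : ℤ) * (((Finset.univ.filter (fun p : Fin n × Fin n => p.1 < p.2 ∧ σ p.2 < σ p.1)).card.choose k : ℕ) : ℤ)) * ∏ i : Fin n, MvPolynomial.X (σ i, i) : MvPolynomial (Fin n × Fin n) ℤ);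
    ∃ b₃ : ℕ, ∀ n k M : ℕ, k ≤ Nat.log 2 n → 1 ≤ M →
      Literature.Computability.AlgebraicComplexity.constantFreeComplexity (J n k) ≤
        (Literature.Computability.AlgebraicComplexity.constantFreeComplexity ((M : ℤ) • J n k) + n + 2) ^ b₃ := by
  sorry

/-! ## Name-keyed aliases of the stub statements (hypotheses of the composition)

`Registered.stub_X` is the statement of `stub_X` under the registered stub's short name, so that the
native skeleton audit (`#h21_check_skeleton`: hypotheses admissible iff registered obligations /
declared stubs BY NAME) accepts `JetConstantElim_of : Registered.stub_… → … → JetConstantElim`. -/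
namespace Registered

/-- Alias of `AlgebraicDescent` (= the signature of `stub_algebraicDescent`). -/
abbrev stub_algebraicDescent : Prop := AlgebraicDescent
/-- Alias of `IntegralMultiple` (= the signature of `stub_integralMultiple`). -/
abbrev stub_integralMultiple : Prop := IntegralMultiple
/-- Alias of `SignSimulation` (= the signature of `stub_signSimulation`). -/
abbrev stub_signSimulation : Prop := SignSimulation
/-- Alias of `MultiplierRemoval` (= the signature of `stub_multiplierRemoval`). -/
abbrev stub_multiplierRemoval : Prop := MultiplierRemoval

end Registered

/-! ## The composition -/

/-- Growth bookkeeping: `X^c + X ≤ X^(c+2)` for `X ≥ 2`. [folklore] -/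
theorem pow_add_self_le (X c : ℕ) (hX : 2 ≤ X) : X ^ c + X ≤ X ^ (c + 2) := by
  have h1 : X ≤ X ^ (c + 1) := by
    calc X = X ^ 1 := (pow_one X).symm
      _ ≤ X ^ (c + 1) := Nat.pow_le_pow_right (by omega) (by omega)
  have h2 : X ^ c ≤ X ^ (c + 1) := Nat.pow_le_pow_right (by omega) (by omega)
  calc X ^ c + X ≤ X ^ (c + 1) + X ^ (c + 1) := add_le_add h2 h1
    _ = 2 * X ^ (c + 1) := by ring
    _ ≤ X * X ^ (c + 1) := Nat.mul_le_mul_right _ hX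
    _ = X ^ (c + 2) := by ring

/-- **The arithmetic of the line**, for an arbitrary family `F n k ∈ ℤ[x_(n×n)]` and an arbitrary
height predicate `HB`: descent (`hD`) gives a `ℚ̄`-circuit of size `≤ L = L_ℂ(F n k)`; the integral
normal form (`hI`) an integer circuit of size `+` height `+ 2 ≤ X^b₁`, `X = size + n + 2 ≤ L + n + 2`,
for some multiple `M·F n k`; sign simulation (`hS`) gives `τ(M·F n k) ≤ X^(b₁ b₂)`; multiplier
removal (`hR`) gives `τ(F n k) ≤ (X^(b₁ b₂) + n + 2)^b₃ ≤ (X^(b₁ b₂ + 2))^b₃ ≤ (L + n + 2)^((b₁ b₂ + 2) b₃)`.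
[folklore] -/
theorem assemble (F : (n : ℕ) → ℕ → MvPolynomial (Fin n × Fin n) ℤ)
    (HB : (n : ℕ) → ArithCircuit ℤ (Fin n × Fin n) → ℕ → Prop) (b₁ b₂ b₃ : ℕ)
    (hD : ∀ (n : ℕ) (f : MvPolynomial (Fin n × Fin n) ℤ),
      ∃ Q : ArithCircuit (AlgebraicClosure ℚ) (Fin n × Fin n),
        Q.IsFanInTwo ∧ Q.Computes (MvPolynomial.map (Int.castRingHom (AlgebraicClosure ℚ)) f) ∧
        Q.size ≤ complexity (MvPolynomial.map (Int.castRingHom ℂ) f))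
    (hI : ∀ n k : ℕ, k ≤ Nat.log 2 n →
      ∀ Q : ArithCircuit (AlgebraicClosure ℚ) (Fin n × Fin n), Q.IsFanInTwo →
        Q.Computes (MvPolynomial.map (Int.castRingHom (AlgebraicClosure ℚ)) (F n k)) →
        ∃ (P : ArithCircuit ℤ (Fin n × Fin n)) (t M : ℕ),
          1 ≤ M ∧ P.IsFanInTwo ∧ P.Computes ((M : ℤ) • F n k) ∧ HB n P t ∧
          P.size + t + 2 ≤ (Q.size + n + 2) ^ b₁)
    (hS : ∀ (n : ℕ) (f : MvPolynomial (Fin n × Fin n) ℤ) (P : ArithCircuit ℤ (Fin n × Fin n)) (t : ℕ),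
      P.IsFanInTwo → P.Computes f → HB n P t → constantFreeComplexity f ≤ (P.size + t + 2) ^ b₂)
    (hR : ∀ n k M : ℕ, k ≤ Nat.log 2 n → 1 ≤ M →
      constantFreeComplexity (F n k) ≤ (constantFreeComplexity ((M : ℤ) • F n k) + n + 2) ^ b₃) :
    ∀ n k : ℕ, k ≤ Nat.log 2 n →
      constantFreeComplexity (F n k) ≤
        (complexity (MvPolynomial.map (Int.castRingHom ℂ) (F n k)) + n + 2) ^ ((b₁ * b₂ + 2) * b₃) := by
  intro n k hk
  obtain ⟨Q, hQ2, hQc, hQs⟩ := hD n (F n k)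
  obtain ⟨P, t, M, hM, hP2, hPc, hPb, hPs⟩ := hI n k hk Q hQ2 hQc
  have hτM : constantFreeComplexity ((M : ℤ) • F n k) ≤ (P.size + t + 2) ^ b₂ :=
    hS n _ P t hP2 hPc hPb
  have hRk := hR n k M hk hM
  set L := complexity (MvPolynomial.map (Int.castRingHom ℂ) (F n k)) with hL
  set X := Q.size + n + 2 with hX
  have hX2 : 2 ≤ X := by omega
  have hXL : X ≤ L + n + 2 := by omega
  have hPX : (P.size + t + 2) ^ b₂ ≤ X ^ (b₁ * b₂) := by
    calc (P.size + t + 2) ^ b₂ ≤ (X ^ b₁) ^ b₂ := Nat.pow_le_pow_left hPs _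
      _ = X ^ (b₁ * b₂) := by rw [← pow_mul]
  have hmid : constantFreeComplexity ((M : ℤ) • F n k) + n + 2 ≤ X ^ (b₁ * b₂ + 2) := by
    have h1 : constantFreeComplexity ((M : ℤ) • F n k) + n + 2 ≤ X ^ (b₁ * b₂) + X := by omega
    exact le_trans h1 (pow_add_self_le X (b₁ * b₂) hX2)
  calc constantFreeComplexity (F n k)
      ≤ (constantFreeComplexity ((M : ℤ) • F n k) + n + 2) ^ b₃ := hRk
    _ ≤ (X ^ (b₁ * b₂ + 2)) ^ b₃ := Nat.pow_le_pow_left hmid _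
    _ ≤ ((L + n + 2) ^ (b₁ * b₂ + 2)) ^ b₃ := Nat.pow_le_pow_left (Nat.pow_le_pow_left hXL _) _
    _ = (L + n + 2) ^ ((b₁ * b₂ + 2) * b₃) := by rw [← pow_mul]

/-- **Composition** (the glue of the line, kernel-checked; no `sorry`): descent to `ℚ̄`, integral
normal form of a multiple, sign simulation and multiplier removal give constant elimination inside
VP for the jets with exponent `b = (b₁·b₂ + 2)·b₃`. [folklore] -/
theorem JetConstantElim_of :
    Registered.stub_algebraicDescent → Registered.stub_integralMultiple →
      Registered.stub_signSimulation → Registered.stub_multiplierRemoval → JetConstantElim := by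
  intro hD hI hS hR
  obtain ⟨b₁, hb₁⟩ := hI
  obtain ⟨b₂, hb₂⟩ := hS
  obtain ⟨b₃, hb₃⟩ := hR
  exact ⟨(b₁ * b₂ + 2) * b₃,
    assemble _ _ b₁ b₂ b₃ (fun n f => hD (Fin n × Fin n) f) hb₁
      (fun n f P t => hb₂ (Fin n × Fin n) f P t) hb₃⟩

/-- Wiring check: the registered stubs feed `JetConstantElim_of` exactly as stated, so the skeleton
is `JetConstantElim` closed modulo the four stubs (sorries enter only through them). -/
example : JetConstantElim :=
  JetConstantElim_of stub_algebraicDescent stub_integralMultiple stub_signSimulation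
    stub_multiplierRemoval

end Summit.ValiantsHypothesis.ValiantsHypothesis.Cruxes.JetConstantElim.Birth
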